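import Summits.BirchSwinnertonDyer.BirchSwinnertonDyer.Theses.PrintX10b
import Literature.NumberTheory.EllipticCurves.Rank1Residual.MuLambdaCarriers
import Literature.NumberTheory.EllipticCurves.Rank1Residual.CyclotomicWindingSpan
import Summits.BirchSwinnertonDyer.Rank1Residual.X10.ClassX10bLeaf
import Summits.BirchSwinnertonDyer.Rank1Residual.X10.LeafDischargeX10b
import Literature.NumberTheory.Automorphic.CongruenceSubgroupPropertySL2Proofs
import Mathlib.RingTheory.Localization.Away.Basic
import HarnessLib

/-!
# LINE `theoremB-x10b` on crux `PrintX10b.AnalyticMuZeroX10b` (stmt-BirchSwinnertonDyer-20682)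
(cell bsd-f3-mu, planner of record `-imc` g7; D-0145 LINE-FIRST skeleton for the W-36 (K) chain; **v4** 20:45Z: stub 2 fact-free (proved, AN9 v2), stub 3 ↦ 3a + 3b)

**Target by name.** `Summit.BirchSwinnertonDyer.BirchSwinnertonDyer.Theses.PrintX10b.AnalyticMuZeroX10b`
(`:= X10.AnalyticMuZeroOnClassX10b`: for every X10b pair (E, 3) — 3 good ordinary, E[3] irreducible, mod-3 image
3Ns/3Nn — some coefficient of `L_3(f_E, α)` is a 3-adic unit, i.e. `μ₃^an(E) = 0`; 883 census pairs).

**Strategy (MEMO-an §12–§13, author bsd-f3-mu-an g3/g4; this file only CUTS the chain into obligation Props).**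
THEOREM B (stubs 1a+1b: (V) = Vaserstein–BMS over `ℤ[1/m]`, cite-only, isolated BY NAME as `stub_vasersteinAway`; and the
cell-proved implication (V) → THEOREM B, group theory in `SL₂(ℤ[1/p])`, -an g5 kernel file): for every level `N` and prime `p ∤ N` the cyclotomic winding
classes `{0 → a/pⁿ}` span `pr Γ_H(N) ⊆ H₁(X₀(N);ℤ)`, `H = ⟨−1,p⟩` (tree `ConjSpanGen N p`).  COROLLARY C2 (stub 2,
Hecke–Eisenstein + Chebotarev/Brauer–Nesbitt): the quotient `H₁/V(N,p)` is `T_ℓ = 1+ℓ`-Eisenstein, the unit-normalised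
plus functional of `f_E` is Hecke with eigenvalues `a_ℓ` and non-zero mod `p`, so for `E[p]` irreducible (`p` odd, good)
`x ↦ [x]⁺ mod p` is NON-CONSTANT on `ℤ[1/p]` (tree `CycWindingNonConstantAt W p`).  COLLAPSE AT 3 (stub 3, MTT measure
at `p = 3`, `ω(ℤ₃ˣ) = {±1}`): non-constancy ⟺ `μ(L_3(f,α)) = 0` for 3-ordinary `W` with `E[3]` irreducible.
Composition `AnalyticMuZeroX10b_of` = -an g4 `Sketch4.analyticMuZeroOnClassX10b_of_odd` (sorry-free, verbatim logic).

**Why this line / why novel.** Image-blind, rank-blind, level-free mechanism for analytic `μ₃ = 0` (Greenberg Conj. 1.11,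
analytic side, at `p = 3`); not in print (ref2 REF2-LITMAP row «an-§13 ThmB», x8-lit DOSSIER T26: NOT-FOUND; nearest:
Sun 2007 JNT 127 §4 Conj. 8 (single layer, conjecture), Greenberg–Vatsal 2000 §3 (congruence transfer needs a partner),
EPW 2006 Thm 1 (constancy in H(ρ̄), needs one anchor)).  Five independent paper reads agree (REF1-AUDIT §3.10 f7dd2f440237eddd;
ref2 THMB-COLD-AUDIT-g8 24cf34fd9d6ba2b4; x8 ref R-79 PASS; x8 plan g5; x8 lit g10 inputs at the page).
Group input alternatives for stub 1: (L) Morris 2007 Thm 6.1(2) + (C) Serre 1970 §2.6 Thm 2(b)/Cor 1/Cor 3, or (V) Vaserstein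
1972 + Bass–Milnor–Serre Thm 3.6 (`SL2Rel.relG ⊤ (N) ≤ SL2Rel.relE ⊤ (N)` over `ℤ[1/p]`, ref2 g8 F-(V); tree template
`SL2Rel.relG_le_relE_span_singleton` over `𝓞_K`).

**bears_on.** rung W-ALL/10 leaf `X10.BSDpOnClassX10b` via `X10.bsdpOnClassX10b_of_facts` (binder `hA` = this crux;
all other binders published facts + the Schneider rider); D-0131 K6/A5 partition X10b 883 = 610 3Ns + 273 3Nn.

**Cheapest falsifier / instruments.** ONE X10b row with certified `μ₃^an > 0` kills stub 2∘3 (X9-MU-TABLE-v1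
361f587418fce70d: 0/1027 valued X10b rows); ONE level `N`, `3 ∤ N`, with `V̄(N,3) ⊉ pr Γ_H` kills stub 1 (0/3 000+ levels:
an/vspan2.py, x8 plan/vs/vspan3.py, x8 ref R-68b integral PARI engine 324/324 N ≤ 500).  RUNNING: W-36 (D) AN-D9
(kit j288574 eclib+num, j288575 PARI: μ₃^an on 508 surjective-image curves OUTSIDE X10b, stratified; one certified
μ₃^an > 0 kills stub 2∘3 as a FAMILY statement) and AN-D9b (kit j288583: direct 𝔽_p-span check of THEOREM B's
Eisenstein-quotient prediction, p ∈ {3,5,7}, N ≤ 200).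

**Disproof used.** none registered on this crux (`ledger crux ls`: no workfiles).  **Dead lines avoided.** EPW/GV partner
transport (needs a certified partner per ρ̄ — x9-plan g1 birth file, evidence 16:09Z) is not used; no image hypothesis.
-/

namespace Summit.BirchSwinnertonDyer.BirchSwinnertonDyer.Cruxes.AnalyticMuZeroX10b.TheoremB

open scoped Classical
open CongruenceSubgroup WeierstrassCurve
open Literature.NumberTheory.EllipticCurves
open Literature.NumberTheory.EllipticCurves.ModularForms
open Literature.NumberTheory.EllipticCurves.Rank1Residual
open Summit.BirchSwinnertonDyer.Rank1Residual.X10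

set_option linter.dupNamespace false

/-- **stub 1a — the single published input (V): Vaserstein 1972 (Theorem) + Bass–Milnor–Serre 1967 (Ch. I Thm 3.6)
at `A = ℤ[1/m]`, `m ≥ 2`: `G(eA, A) ≤ E(eA, A)` for every integer `e ≥ 1`.**  CHARACTER-FOR-CHARACTER the hypothesis
`h` of the tree's `Literature.NumberTheory.Automorphic.congruenceSubgroupProperty_away_of_relG_le_relE`
(`CongruenceSubgroupPropertySL2Away.lean`) and of -an g5 `AnLens5.conjSpanGenAll_of_vaserstein_away`
(HOME/an/g5/TheoremB.lean 583a2ab32092eff9).  A published theorem, cite-only tonight; two sorry-free discharges are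
foreseen: (K-b) port of the tree's `𝓞_K` proof `SL2Rel.relG_le_relE_span_singleton`
(`CongruenceSubgroupPropertySL2Holds.lean`; hypotheses = a real place + a unit of infinite order, both true for `ℤ[1/m]`)
to `Localization.Away`; or x8 ty2 g6 `SL2Rel.relG_top_span_le_relE_of_morris_of_serre hL hC`
(`SL2AwayRelativeElementary.lean`, staged) from the tree facts (L) `Morris2007.thm61_2_elementary_boundedlyGenerates`
and (C) `SerreSL2Congruence1970_congruenceSubgroupProperty_away` once THOSE are proved.  Size L (port).
[Vaserstein1972SL2, Theorem; BassMilnorSerre1967, Ch. I Thm 3.6; SerreSL2Congruence1970 §2.6 Cor 3; Morris2007 Thm 6.1(2)] -/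
theorem stub_vasersteinAway :
    ∀ (m : ℕ), 2 ≤ m → ∀ e : ℕ, e ≠ 0 →
      Literature.NumberTheory.Automorphic.SL2Rel.relG (Ideal.span {(e : Localization.Away (m : ℤ))}) ⊤ ≤
        Literature.NumberTheory.Automorphic.SL2Rel.relE (Ideal.span {(e : Localization.Away (m : ℤ))})
          (⊤ : Ideal (Localization.Away (m : ℤ))) := by
  sorry

/-- **stub 1b — THEOREM B from (V) (AN-10 `ConjSpanGenAll`, MEMO-an §13.1–13.2; the cell's own mathematics):** for every
level `N` and every prime `p ∤ N`, every `γ ∈ Γ_H(N)` (`d ≡ ±pᵏ mod N`) lies in `⟨good (|d| = pᵐ), finite-order,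
trace ±2⟩ · [Γ₀(N),Γ₀(N)]` (tree `ConjSpanGen`; through Manin's dictionary: `{0 → a/pⁿ}` span `pr Γ_H(N)`), GIVEN (V).
KERNEL-PROVED by -an g5: `AnLens5.conjSpanGenAll_of_vaserstein_away : (V) → ConjSpanGenAll` with
`ConjSpanGenAll := ∀ (N p : ℕ), p.Prime → ¬ p ∣ N → ConjSpanGen N p` (HOME/an/g5/TheoremB.lean, 819 lines, rc 0,
0 sorry, axioms std: orbit trick in `SL₂(ℤ[1/p])`, `Δ = Γ₀(N)·B⁺ = Γ₀(N)·B⁻_N`, transpose bridge) — the prover lands that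
file in `Theorems/` with the one-line wrapper `theorem stub_theoremB_of_vasersteinAway := fun h =>
conjSpanGenAll_of_vaserstein_away h` (`--supports stmt-BirchSwinnertonDyer-20682`).  Size S (landing).
[MEMO-an §13; x8 ref R-79 PASS; ref2 THMB-COLD-AUDIT-g8 NO GAP] -/
theorem stub_theoremB_of_vasersteinAway :
    (∀ (m : ℕ), 2 ≤ m → ∀ e : ℕ, e ≠ 0 →
      Literature.NumberTheory.Automorphic.SL2Rel.relG (Ideal.span {(e : Localization.Away (m : ℤ))}) ⊤ ≤
        Literature.NumberTheory.Automorphic.SL2Rel.relE (Ideal.span {(e : Localization.Away (m : ℤ))})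
          (⊤ : Ideal (Localization.Away (m : ℤ)))) →
      ∀ (N p : ℕ), p.Prime → ¬ p ∣ N → ConjSpanGen N p := by
  sorry

/-- **stub 2 — COROLLARY C2 (AN-9 from THEOREM B, MEMO-an §13.3 (C2)(a)–(e)):** THEOREM B ⟹ for every elliptic
`E/ℚ`, every odd prime `p` of good reduction with `E[p]` irreducible, `x ↦ [x]⁺ mod p` is non-constant on `ℤ[1/p]`.
Size L in Lean (Hecke action on `H₁(X₀(N);ℤ)` with `T_ℓ = 1 + ℓ` on the χ-quotient, `Φ_f : H₁ ↠ ℤ` from `re Λ_f = ℤΩ⁺_f/2`,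
`a_ℓ ≡ 1 + ℓ ∀ ℓ ⟹ ρ̄^ss = 1 ⊕ ω` by Chebotarev + Brauer–Nesbitt, level = conductor by Carayol).
[MEMO-an §13.3; Manin1972 Thm 1.9; GreenbergLNM1716 Conj 1.11] -/
theorem stub_nonconstancy_of_theoremB :
    (∀ (N p : ℕ), p.Prime → ¬ p ∣ N → ConjSpanGen N p) →
      ∀ (W : WeierstrassCurve ℚ) [W.IsElliptic] [W.IsGloballyMinimal] (p : ℕ) [Fact p.Prime],
        p ≠ 2 → W.HasGoodReductionAtPrime p → W.HasIrreducibleModPGaloisRep p →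
          CycWindingNonConstantAt W p := by
  sorry

/-- **stub 3a — the `p = 3` collapse, modular-symbol half (AN-S4₃(i), -an g5 TAKEN 20:34:02Z, target VERBATIM):**
for 3-ordinary `W` with newform `f` and `E[3]` irreducible, non-constancy of `x ↦ [x]⁺ mod 3` on `ℤ[1/3]` yields a UNIT
value of the Mazur–Swinnerton-Dyer plus measure `μ_{f,α}` on some ball `a + 3^{m+1}ℤ₃` with `a` a unit
(`D_m` induction from the distribution relation `msdMeasure_distribution`, total mass `(1 − α⁻¹)²[0]⁺`, 3-integrality of
`[·]⁺` for `E[3]` irreducible — `padicLFunction_mem_integral` / Stevens).  Size M.  [MEMO-an §12.1; MTT1986 §I.10 (10.1)–(10.2)] -/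
theorem stub_unitMeasure_of_nonconstancy :
    ∀ (W : WeierstrassCurve ℚ) [W.IsElliptic] [W.IsGloballyMinimal] {N : ℕ} [NeZero N] (f : CuspForm (Gamma0 N) 2),
      IsOrdinaryAt W 3 → IsNewformOf W f → W.HasIrreducibleModPGaloisRep 3 → CycWindingNonConstantAt W 3 →
        ∃ (m : ℕ) (a : ZMod (3 ^ (m + 1))), IsUnit a ∧ 1 ≤ ‖msdMeasure f (unitRoot W 3 : ℚ_[3]) (m + 1) a‖ := by
  sorry

/-- **stub 3b — the `p = 3` collapse, measure-to-coefficient half (AN-S4₃(ii) = AN-S1/S2 at `p = 3`; bsd-print-x9 p2 g3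
TAKEN 20:31:53Z as an abstract `PAdicMeasureTransform` lemma + this specialisation):** a unit value of `μ_{f,α}` on a ball
inside `ℤ₃ˣ` forces a unit coefficient of `L_3(f, α) = ∫ (1+T)^{log⟨x⟩} dμ` — at `p = 3` the `ω`-orbit is `{±u}` and the plus
measure is even, so the pushforward to `1 + 3ℤ₃` has the unit value `2·μ(±a + 3^{m+1}ℤ₃)`; Newton inversion of the
Riemann sums `RS(k,n) = Σ_s ν_n(s)·C(s,k)` with the tree's bound `‖c_k − RS(k,n)‖ ≤ 3⁻¹` (`k < 3ⁿ`,
`PAdicLFunctionRiemannSumCongruenceCertificateProofs`) and integrality of the coefficients.  Size M.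
[MTT1986 §I.11; SteinWuthrich2013 (3.2); MEMO-an §10.3] -/
theorem stub_muAnZero_of_unitMeasure :
    ∀ (W : WeierstrassCurve ℚ) [W.IsElliptic] [W.IsGloballyMinimal] {N : ℕ} [NeZero N] (f : CuspForm (Gamma0 N) 2),
      IsOrdinaryAt W 3 → IsNewformOf W f → W.HasIrreducibleModPGaloisRep 3 →
        (∃ (m : ℕ) (a : ZMod (3 ^ (m + 1))), IsUnit a ∧ 1 ≤ ‖msdMeasure f (unitRoot W 3 : ℚ_[3]) (m + 1) a‖) →
          ∃ n : ℕ, ‖PowerSeries.coeff n (padicLFunction f (unitRoot W 3 : ℚ_[3]))‖ = 1 := by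
  sorry

/-- **Composition (kernel-checked; the only `sorry`s are inside the registered `stub_*` obligations, invoked BY NAME):
stub 1a (the ONE cite-only input (V)) → stub 1b → stub 2 → stub 3a → stub 3b → the ROUTE decl by name.**
(**v4**, 20:45Z: stub 2 back to the fact-free v2 signature — -an g5 AN9.lean v2 2accc625eee21839 proves it VERBATIM with
NO named facts (ref2 g9 concurs: F1 via `IsNewformOf.dvd_level_iff_dvd_conductorNorm`, F2 via
`not_irreducible_of_frobeniusTrace_congr_off_finite`, both tree theorems); v3's cite stubs F1/F2 WITHDRAWN; stub 3 split into
3a (-an, modular-symbol half, target verbatim 20:34:02Z) and 3b (x9 p2 g3, measure → coefficient half).)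
(= -an g4 `Sketch4.analyticMuZeroOnClassX10b_of_odd`, instantiated at `p = 3` through `ClassX10`.) -/
theorem AnalyticMuZeroX10b_of :
    Summit.BirchSwinnertonDyer.BirchSwinnertonDyer.Theses.PrintX10b.AnalyticMuZeroX10b := by
  intro W _ _ p _ N _ f hX _hns hf
  obtain ⟨rfl, -⟩ := id hX
  exact stub_muAnZero_of_unitMeasure W f hX.isOrdinaryAt_three hf hX.irr_three
    (stub_unitMeasure_of_nonconstancy W f hX.isOrdinaryAt_three hf hX.irr_three
      (stub_nonconstancy_of_theoremB (stub_theoremB_of_vasersteinAway stub_vasersteinAway) W 3 (by decide)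
        hX.isOrdinaryAt_three.1 hX.irr_three))

end Summit.BirchSwinnertonDyer.BirchSwinnertonDyer.Cruxes.AnalyticMuZeroX10b.TheoremB
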